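import Summits.ValiantsHypothesis.ValiantsHypothesis.Theses.DepthWindow
import Summits.ValiantsHypothesis.ValiantsHypothesis.Theorems.DepthWindowHomRelTwoMul
import HarnessLib

/-!
# Route `DepthWindow`, gen-3 split of `PerHardLog3` — the support child `HomTwoOne` holds

`HomTwoOne` (item stmt-ValiantsHypothesis-30636) is Limaye–Srinivasan–Tavenas's homogenisation at
slope `2` (Lemma 11: product-depth `Δ ↦ 2Δ + O(1)`, size `(s + |σ| + 2)^a · 2^{a d²}`); it is literally
`HomAtSlope 2 1` of `DepthWindowSlopeRate.lean`, proved in the tree as `homAtSlope_two_one`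
(`DepthWindowHomRelTwoMul.lean`, via the relative block lemma `HomRel(1,2)` and additive stacking).
[cite: LimayeSrinivasanTavenas2025, Lemma 11]
-/

-- layout Summits/ValiantsHypothesis/ValiantsHypothesis forces the duplicated namespace component
set_option linter.dupNamespace false

namespace Summit.ValiantsHypothesis.ValiantsHypothesis.Theorems.DepthWindow

/-- The support child `HomTwoOne` of the gen-3 split of `PerHardLog3` holds (kernel: LST Lemma 11 in
the form `homAtSlope_two_one`). [cite: LimayeSrinivasanTavenas2025, Lemma 11] -/
theorem homTwoOne_holds : Summit.ValiantsHypothesis.ValiantsHypothesis.Theses.DepthWindow.HomTwoOne :=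
  homAtSlope_two_one

end Summit.ValiantsHypothesis.ValiantsHypothesis.Theorems.DepthWindow
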